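import Literature.Geometry.Riemannian.MassDistribution
import Literature.Geometry.Riemannian.MetricFlowSliceUnionBounds
import Mathlib.MeasureTheory.Integral.Average
import HarnessLib

/-!
# Finite approximation of a metric measure space with bounded variance and mass distribution
# (Bamler 2023, §2.5, Lemma (finite approximation))

R. Bamler, *Compactness theory of the space of super Ricci flows*, Invent. Math. 233 (2023), §2.5,
the Lemma used for the total boundedness of `𝕄_r(V, b)`: *"there is a finite subset
`X' ⊂ supp X` and a measure `μ' ∈ 𝒫(X)` with `supp μ' ⊂ X'` such that
`d_{GW₁}((X, d, μ), (X', d|_{X'}, μ')) ≤ d_{W₁}(μ, μ') ≤ α r` and such that `(X', d|_{X'})` has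
diameter `≤ N r`, `#X' ≤ N`"*. We follow the printed proof at one scale `ρ = ε r`: choose `x₀`
with `Var(δ_{x₀}, μ) ≤ Var(μ)`; choose a maximal set `{x₁, …, x_m}` with pairwise disjoint closed
`ρ`-balls of mass `≥ β = b(ε)` (so `m ≤ β⁻¹`); every `x` off `Y := ⋃ D(xᵢ, 2ρ)` has
`μ(D(x, ρ)) < β`, whence `μ(X ∖ Y) ≤ ε`; the distances satisfy
`d(xᵢ, xⱼ) − 2ρ ≤ β⁻² ∫∫ d ≤ β⁻² V^{1/2}`, `d(x₀, xᵢ) − ρ ≤ β⁻¹ V^{1/2}`; and the map `T` sending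
`Y ∋ y ↦` (the first) `xᵢ` with `y ∈ D(xᵢ, 2ρ)` and `X ∖ Y ∋ y ↦ x₀` has transport cost
`∫ d(y, T y) dμ ≤ μ(X ∖ Y)^{1/2} (∫ d²(y, x₀) dμ)^{1/2} + 2ρ ≤ (ε V)^{1/2} + 2ρ` (the printed coupling
`q = μ|_{X∖Y} ⊗ δ_{x₀} + Σ μ|_{Yᵢ} ⊗ δ_{xᵢ}` is the deterministic coupling along `T`). The model
is indexed by the fixed finite set `Fin (⌊β⁻¹⌋₊ + 1)` (unused indices repeat `x₀`), as needed
for the compactness argument; the rounding of the masses to `N⁻¹ ℤ` is not performed here.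

* `exists_finite_approximation` — **the Lemma** (points `x`, index map `T`, distance bound,
  transport cost);
* `wassersteinW1_map_le_lintegral_edist` — `d_{W₁}(μ, T_* μ) ≤ ∫ d(y, T y) dμ`.

Everything is proved; no definitions, no named facts.

## References

* R. H. Bamler, *Compactness theory of the space of super Ricci flows*, Invent. Math. 233 (2023),
  §2.5, Lemma (finite approximation, used for the Theorem that 𝕄_r(V, b) is compact), proof.
  [Bamler2023]
-/

noncomputable section

open Set MeasureTheory Filter Topology Metric Function
open scoped ENNReal NNReal

namespace Literature.Geometry.Riemannian

variable {X : Type*} [MetricSpace X] [MeasurableSpace X] [BorelSpace X]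

/-! ### The deterministic coupling -/

/-- **`d_{W₁}(μ, T_* μ) ≤ ∫ d(y, T(y)) dμ(y)`**: the deterministic coupling `(id, T)_* μ`.
[cite: Bamler2023, §2.5, proof of the Lemma (finite approximation), the coupling q] -/
theorem wassersteinW1_map_le_lintegral_edist [SecondCountableTopology X] (μ : Measure X)
    [IsProbabilityMeasure μ] {T : X → X} (hT : Measurable T) :
    wassersteinW1 μ (μ.map T) ≤ ∫⁻ y, edist y (T y) ∂μ := by
  have hm : Measurable fun y ↦ (y, T y) := measurable_id.prodMk hT
  have hc : IsCoupling μ (μ.map T) (μ.map fun y ↦ (y, T y)) := by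
    refine ⟨Measure.isProbabilityMeasure_map hm.aemeasurable, ?_, ?_⟩
    · rw [Measure.fst, Measure.map_map measurable_fst hm]
      exact Measure.map_id
    · rw [Measure.snd, Measure.map_map measurable_snd hm]
      rfl
  refine (wassersteinW1_le_lintegral hc).trans_eq ?_
  exact lintegral_map measurable_edist hm

/-! ### `∫∫ d ≤ Var^{1/2}` -/

/-- `∫ d(x₀, z) dμ(z) ≤ (∫ d²(x₀, z) dμ(z))^{1/2}` on a probability space. [folklore] -/
theorem lintegral_edist_le_rpow_half [SecondCountableTopology X] (μ : Measure X)
    [IsProbabilityMeasure μ] (x₀ : X) :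
    ∫⁻ z, edist x₀ z ∂μ ≤ (∫⁻ z, edist x₀ z ^ 2 ∂μ) ^ (1 / 2 : ℝ) := by
  have h := lintegral_rpow_half_le μ (g := fun z ↦ edist x₀ z ^ 2)
    ((measurable_const.edist measurable_id).pow_const 2).aemeasurable
  have h2 : ∀ z, (edist x₀ z ^ 2 : ℝ≥0∞) ^ (1 / 2 : ℝ) = edist x₀ z := fun z ↦ by
    rw [← ENNReal.rpow_ofNat _ 2, ← ENNReal.rpow_mul]
    norm_num
  simp_rw [h2] at h
  exact h

/-- **`∫∫ d(y, z) dμ dμ ≤ Var(μ)^{1/2}`** on a probability space (Cauchy–Schwarz twice). This is the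
diagonal case `μ₁ = μ₂ = μ` of `lintegral_lintegral_edist_le_sqrt_variance`
(`MetricFlowVarianceBounds.lean`); kept as a deprecated restatement (dedup-02694).
[cite: Bamler2023, §2.5, proof of the Lemma (finite approximation), diameter bound] -/
@[deprecated lintegral_lintegral_edist_le_sqrt_variance (since := "2026-08-17")]
theorem lintegral_lintegral_edist_le_variance_rpow_half [SecondCountableTopology X] (μ : Measure X)
    [IsProbabilityMeasure μ] :
    ∫⁻ y, ∫⁻ z, edist y z ∂μ ∂μ ≤ (variance μ μ) ^ (1 / 2 : ℝ) :=
  lintegral_lintegral_edist_le_sqrt_variance μ μ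

/-! ### The Lemma -/

variable [SecondCountableTopology X]

/-- **Finite approximation** (Bamler 2023, §2.5, the Lemma behind the compactness of `𝕄_r(V, b)`,
at one scale `ρ`): if `Var(μ) ≤ V` and `μ({x : μ(D(x, ρ)) < β}) ≤ ε` with `0 < β ≤ 1`, there are
points `x_p` (`p ∈ Fin (⌊β⁻¹⌋₊ + 1)`; `x₀` and the centers of a maximal packing by disjoint
`ρ`-balls of mass `≥ β`, padded by `x₀`) with all mutual distances `≤ V^{1/2} β⁻² + 2ρ`, and a
measurable index map `T` with `∫ d(y, x_{T(y)}) dμ(y) ≤ (ε V)^{1/2} + 2ρ`.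
[cite: Bamler2023, §2.5, Lemma (finite approximation), proof] -/
theorem exists_finite_approximation (μ : Measure X) [IsProbabilityMeasure μ] {V ρ ε : ℝ}
    {β : ℝ≥0∞} (hV0 : 0 ≤ V) (hV : variance μ μ ≤ ENNReal.ofReal V) (hρ : 0 < ρ) (hβ0 : β ≠ 0)
    (hβ1 : β ≤ 1) (hε : 0 ≤ ε) (hthin : μ (thinSet μ ρ β) ≤ ENNReal.ofReal ε) :
    ∃ (x : Fin (⌊β.toReal⁻¹⌋₊ + 1) → X) (T : X → Fin (⌊β.toReal⁻¹⌋₊ + 1)), Measurable T ∧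
      (∀ p q, dist (x p) (x q) ≤ Real.sqrt V / β.toReal ^ 2 + 2 * ρ) ∧
      ∫⁻ y, edist y (x (T y)) ∂μ ≤ ENNReal.ofReal (Real.sqrt (ε * V) + 2 * ρ) := by
  classical
  set N := ⌊β.toReal⁻¹⌋₊ with hN
  have hβtop : β ≠ ∞ := ne_top_of_le_ne_top ENNReal.one_ne_top hβ1
  have hβr : 0 < β.toReal := ENNReal.toReal_pos hβ0 hβtop
  have hβr1 : β.toReal ≤ 1 := by
    have := ENNReal.toReal_mono ENNReal.one_ne_top hβ1
    rwa [ENNReal.toReal_one] at this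
  have hβeq : ENNReal.ofReal β.toReal = β := ENNReal.ofReal_toReal hβtop
  -- `∫∫ d ≤ √V`, `∫ d(x₀, ·) ≤ √V`
  -- `(ofReal a)^{1/2} = ofReal √a` (as in `BoseGas.ofReal_rpow_half_eq_sqrt`)
  have hhalf : ∀ {a : ℝ}, 0 ≤ a → (ENNReal.ofReal a) ^ (1 / 2 : ℝ) = ENNReal.ofReal (Real.sqrt a) :=
    fun ha ↦ by rw [ENNReal.ofReal_rpow_of_nonneg ha (by norm_num), Real.sqrt_eq_rpow]
  have hsqrtV : (variance μ μ) ^ (1 / 2 : ℝ) ≤ ENNReal.ofReal (Real.sqrt V) := by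
    rw [← hhalf hV0]
    exact ENNReal.rpow_le_rpow hV (by norm_num)
  have hdd : ∫⁻ y, ∫⁻ z, edist y z ∂μ ∂μ ≤ ENNReal.ofReal (Real.sqrt V) :=
    (lintegral_lintegral_edist_le_sqrt_variance μ μ).trans hsqrtV
  -- Step 1: `x₀` with `Var(δ_{x₀}, μ) ≤ Var(μ) ≤ V`
  obtain ⟨x₀, hx₀⟩ : ∃ x₀, ∫⁻ z, edist x₀ z ^ 2 ∂μ ≤ ENNReal.ofReal V := by
    have hmeasV : Measurable fun z : X ↦ ∫⁻ y, edist z y ^ 2 ∂μ :=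
      (measurable_edist.pow_const 2).lintegral_prod_right'
    obtain ⟨x₀, h⟩ := exists_le_lintegral (μ := μ) hmeasV.aemeasurable
    exact ⟨x₀, h.trans (by rw [← variance_def]; exact hV)⟩
  have hx₀d : ∫⁻ z, edist x₀ z ∂μ ≤ ENNReal.ofReal (Real.sqrt V) := by
    refine (lintegral_edist_le_rpow_half μ x₀).trans ?_
    rw [← hhalf hV0]
    exact ENNReal.rpow_le_rpow hx₀ (by norm_num)
  -- Step 2: packings by disjoint `ρ`-balls of mass `≥ β`
  let Valid : Finset X → Prop := fun S ↦
    (∀ s ∈ S, β ≤ μ (closedBall s ρ)) ∧ (S : Set X).PairwiseDisjoint fun s ↦ closedBall s ρ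
  have hcard : ∀ S, Valid S → S.card ≤ N := by
    rintro S ⟨hmass, hdisj⟩
    have h1 : (S.card : ℝ≥0∞) * β ≤ 1 := by
      calc (S.card : ℝ≥0∞) * β = ∑ s ∈ S, β := by rw [Finset.sum_const, nsmul_eq_mul]
        _ ≤ ∑ s ∈ S, μ (closedBall s ρ) := Finset.sum_le_sum fun s hs ↦ hmass s hs
        _ = μ (⋃ s ∈ S, closedBall s ρ) :=
            (measure_biUnion_finset hdisj fun _ _ ↦ measurableSet_closedBall).symm
        _ ≤ 1 := prob_le_one
    have h2 : (S.card : ℝ) * β.toReal ≤ 1 := by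
      have := ENNReal.toReal_mono ENNReal.one_ne_top h1
      rwa [ENNReal.toReal_mul, ENNReal.toReal_natCast, ENNReal.toReal_one] at this
    refine Nat.le_floor ?_
    rw [inv_eq_one_div, le_div_iff₀ hβr]
    exact h2
  let P : ℕ → Prop := fun k ↦ ∃ S, Valid S ∧ S.card = k
  have hP0 : P 0 := ⟨∅, ⟨by simp, by simp⟩, rfl⟩
  obtain ⟨S₀, hS₀, hS₀card⟩ : P (Nat.findGreatest P N) := Nat.findGreatest_spec (Nat.zero_le N) hP0
  have hmN : S₀.card ≤ N := hS₀card ▸ Nat.findGreatest_le N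
  -- maximality: every heavy ball meets a packing ball
  have hmax : ∀ y, β ≤ μ (closedBall y ρ) → ∃ s ∈ S₀, dist y s ≤ 2 * ρ := by
    intro y hy
    by_contra hcon
    push Not at hcon
    have hyS : y ∉ S₀ := fun h ↦ by
      have := hcon y h
      rw [dist_self] at this
      linarith
    have hval : Valid (insert y S₀) := by
      refine ⟨fun s hs ↦ ?_, ?_⟩
      · rcases Finset.mem_insert.1 hs with rfl | hs
        · exact hy
        · exact hS₀.1 s hs
      · rw [Finset.coe_insert]
        refine hS₀.2.insert fun s hs _ ↦ ?_
        rw [Set.disjoint_left]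
        intro z hz hz'
        rw [mem_closedBall] at hz hz'
        have := hcon s hs
        linarith [dist_triangle y z s, dist_comm z y]
    have hcard' : (insert y S₀).card = Nat.findGreatest P N + 1 := by
      rw [Finset.card_insert_of_notMem hyS, hS₀card]
    have hle : Nat.findGreatest P N + 1 ≤ N := hcard' ▸ hcard _ hval
    exact Nat.findGreatest_is_greatest (Nat.lt_succ_self _) hle ⟨_, hval, hcard'⟩
  -- Step 3: enumerate the centers
  set m := S₀.card with hm
  let c : Fin m → X := fun i ↦ (S₀.equivFin.symm i : X)
  have hcmem : ∀ i, c i ∈ S₀ := fun i ↦ (S₀.equivFin.symm i).2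
  have hcinj : Function.Injective c := fun i j h ↦
    S₀.equivFin.symm.injective (Subtype.ext h)
  have hcov : ∀ y, β ≤ μ (closedBall y ρ) → ∃ i : Fin m, y ∈ closedBall (c i) (2 * ρ) := by
    intro y hy
    obtain ⟨s, hs, hys⟩ := hmax y hy
    refine ⟨S₀.equivFin ⟨s, hs⟩, ?_⟩
    rw [mem_closedBall]
    have : c (S₀.equivFin ⟨s, hs⟩) = s := by
      simp only [c, Equiv.symm_apply_apply]
    rw [this]
    exact hys
  -- Step 4: the index map
  let Q : X → ℕ → Prop := fun y k ↦ ∃ hk : k < m, y ∈ closedBall (c ⟨k, hk⟩) (2 * ρ)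
  have hQset : ∀ k, MeasurableSet {y | Q y k} := by
    intro k
    by_cases hk : k < m
    · have : {y | Q y k} = closedBall (c ⟨k, hk⟩) (2 * ρ) := by
        ext y
        exact ⟨fun ⟨_, h⟩ ↦ h, fun h ↦ ⟨hk, h⟩⟩
      rw [this]
      exact measurableSet_closedBall
    · have : {y | Q y k} = ∅ := by
        ext y
        simp only [mem_setOf_eq, mem_empty_iff_false, iff_false]
        exact fun ⟨h, _⟩ ↦ hk h
      rw [this]
      exact MeasurableSet.empty
  let T' : X → ℕ := fun y ↦ if h : ∃ k, Q y k then Nat.find h + 1 else 0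
  have hT'0 : ∀ y, (¬ ∃ k, Q y k) → T' y = 0 := fun y h ↦ dif_neg h
  have hT'pos : ∀ y (h : ∃ k, Q y k), T' y = Nat.find h + 1 := fun y h ↦ dif_pos h
  have hT'meas : Measurable T' := by
    refine measurable_to_countable' fun n ↦ ?_
    rcases n with _ | k
    · have : T' ⁻¹' {0} = ⋂ k, {y | Q y k}ᶜ := by
        ext y
        simp only [mem_preimage, mem_singleton_iff, mem_iInter, mem_compl_iff, mem_setOf_eq]
        constructor
        · intro h k hk
          have h' := hT'pos y ⟨k, hk⟩
          rw [h] at h'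
          exact Nat.succ_ne_zero _ h'.symm
        · intro h
          exact hT'0 y (not_exists.2 h)
      rw [this]
      exact MeasurableSet.iInter fun k ↦ (hQset k).compl
    · have : T' ⁻¹' {k + 1} = {y | Q y k} ∩ ⋂ j ∈ Finset.range k, {y | Q y j}ᶜ := by
        ext y
        simp only [mem_preimage, mem_singleton_iff, mem_inter_iff, mem_iInter, mem_compl_iff,
          mem_setOf_eq, Finset.mem_range]
        constructor
        · intro h
          by_cases hex : ∃ k, Q y k
          · rw [hT'pos y hex, Nat.succ_inj] at h
            rw [Nat.find_eq_iff] at h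
            exact h
          · rw [hT'0 y hex] at h
            exact absurd h (Nat.succ_ne_zero _).symm
        · rintro ⟨hk, hlt⟩
          have hex : ∃ k, Q y k := ⟨k, hk⟩
          rw [hT'pos y hex, Nat.succ_inj, Nat.find_eq_iff]
          exact ⟨hk, hlt⟩
      rw [this]
      exact (hQset k).inter (MeasurableSet.iInter fun j ↦ MeasurableSet.iInter fun _ ↦
        (hQset j).compl)
  have hT'le : ∀ y, T' y ≤ m := by
    intro y
    by_cases hex : ∃ k, Q y k
    · rw [hT'pos y hex]
      exact (Nat.find_spec hex).1
    · rw [hT'0 y hex]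
      exact Nat.zero_le _
  let T : X → Fin (N + 1) := fun y ↦ ⟨T' y, Nat.lt_succ_of_le ((hT'le y).trans hmN)⟩
  have hTmeas : Measurable T := by
    have : T = (fun n : ℕ ↦ (⟨min n N, Nat.lt_succ_of_le (min_le_right _ _)⟩ : Fin (N + 1))) ∘ T' := by
      funext y
      apply Fin.ext
      simp only [T, comp_apply]
      exact (min_eq_left ((hT'le y).trans hmN)).symm
    rw [this]
    exact measurable_from_nat.comp hT'meas
  let x : Fin (N + 1) → X := fun p ↦
    if h : 0 < p.val ∧ p.val ≤ m then c ⟨p.val - 1, by omega⟩ else x₀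
  -- values of `x ∘ T`
  have hxT_in : ∀ y (h : ∃ k, Q y k), dist y (x (T y)) ≤ 2 * ρ := by
    intro y h
    obtain ⟨hk, hmemk⟩ := Nat.find_spec h
    have hval : (T y).val = Nat.find h + 1 := hT'pos y h
    have hx : x (T y) = c ⟨Nat.find h, hk⟩ := by
      simp only [x]
      rw [dif_pos ⟨by rw [hval]; exact Nat.succ_pos _, by rw [hval]; exact hk⟩]
      congr 1
      apply Fin.ext
      simp only [hval, Nat.add_sub_cancel]
    rw [hx]
    exact hmemk
  have hxT_out : ∀ y, (¬ ∃ k, Q y k) → x (T y) = x₀ ∧ y ∈ thinSet μ ρ β := by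
    intro y h
    have hval : (T y).val = 0 := hT'0 y h
    refine ⟨?_, ?_⟩
    · simp only [x]
      rw [dif_neg]
      rw [hval]
      exact fun h' ↦ (lt_irrefl 0 h'.1)
    · rw [mem_thinSet]
      by_contra hge
      rw [not_lt] at hge
      obtain ⟨i, hi⟩ := hcov y hge
      exact h ⟨i.val, i.isLt, hi⟩
  -- Step 5: the transport cost
  have hpt : ∀ y, edist y (x (T y)) ≤
      (thinSet μ ρ β).indicator (fun _ ↦ (1 : ℝ≥0∞)) y * edist x₀ y + ENNReal.ofReal (2 * ρ) := by
    intro y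
    by_cases h : ∃ k, Q y k
    · calc edist y (x (T y)) ≤ ENNReal.ofReal (2 * ρ) := by
            rw [edist_dist]
            exact ENNReal.ofReal_le_ofReal (hxT_in y h)
        _ ≤ _ := le_add_self
    · obtain ⟨hx, hmem⟩ := hxT_out y h
      rw [hx, indicator_of_mem hmem, one_mul, edist_comm]
      exact le_self_add
  have hmeasThin : MeasurableSet (thinSet μ ρ β) := measurableSet_thinSet μ ρ β
  have hCS : ∫⁻ y, (thinSet μ ρ β).indicator (fun _ ↦ (1 : ℝ≥0∞)) y * edist x₀ y ∂μ ≤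
      ENNReal.ofReal (Real.sqrt (ε * V)) := by
    have hf : AEMeasurable (fun y ↦ (thinSet μ ρ β).indicator (fun _ ↦ (1 : ℝ≥0∞)) y) μ :=
      (measurable_const.indicator hmeasThin).aemeasurable
    have hg : AEMeasurable (fun y ↦ edist x₀ y) μ :=
      (measurable_const.edist measurable_id).aemeasurable
    have hH := ENNReal.lintegral_mul_le_Lp_mul_Lq μ Real.HolderConjugate.two_two hf hg
    have h1 : ∫⁻ y, (thinSet μ ρ β).indicator (fun _ ↦ (1 : ℝ≥0∞)) y ^ (2 : ℝ) ∂μ =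
        μ (thinSet μ ρ β) := by
      have : (fun y ↦ (thinSet μ ρ β).indicator (fun _ ↦ (1 : ℝ≥0∞)) y ^ (2 : ℝ)) =
          (thinSet μ ρ β).indicator fun _ ↦ (1 : ℝ≥0∞) := by
        funext y
        by_cases hy : y ∈ thinSet μ ρ β
        · rw [indicator_of_mem hy, ENNReal.one_rpow]
        · rw [indicator_of_notMem hy, ENNReal.zero_rpow_of_pos (by norm_num)]
      rw [this, lintegral_indicator hmeasThin, setLIntegral_const, one_mul]
    have h2 : ∫⁻ y, edist x₀ y ^ (2 : ℝ) ∂μ = ∫⁻ y, edist x₀ y ^ 2 ∂μ :=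
      lintegral_congr fun y ↦ ENNReal.rpow_ofNat _ 2
    rw [h1, h2] at hH
    refine hH.trans ?_
    calc μ (thinSet μ ρ β) ^ (1 / (2 : ℝ)) * (∫⁻ y, edist x₀ y ^ 2 ∂μ) ^ (1 / (2 : ℝ))
        ≤ (ENNReal.ofReal ε) ^ (1 / (2 : ℝ)) * (ENNReal.ofReal V) ^ (1 / (2 : ℝ)) := by
          gcongr
      _ = ENNReal.ofReal (Real.sqrt (ε * V)) := by
          rw [hhalf hε, hhalf hV0, ← ENNReal.ofReal_mul (Real.sqrt_nonneg _), ← Real.sqrt_mul hε]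
  have hcost : ∫⁻ y, edist y (x (T y)) ∂μ ≤ ENNReal.ofReal (Real.sqrt (ε * V) + 2 * ρ) := by
    calc ∫⁻ y, edist y (x (T y)) ∂μ
        ≤ ∫⁻ y, (thinSet μ ρ β).indicator (fun _ ↦ (1 : ℝ≥0∞)) y * edist x₀ y +
            ENNReal.ofReal (2 * ρ) ∂μ := lintegral_mono hpt
      _ = ∫⁻ y, (thinSet μ ρ β).indicator (fun _ ↦ (1 : ℝ≥0∞)) y * edist x₀ y ∂μ +
            ENNReal.ofReal (2 * ρ) := by
          rw [lintegral_add_right _ measurable_const, lintegral_const, measure_univ, mul_one]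
      _ ≤ ENNReal.ofReal (Real.sqrt (ε * V)) + ENNReal.ofReal (2 * ρ) := add_le_add hCS le_rfl
      _ = ENNReal.ofReal (Real.sqrt (ε * V) + 2 * ρ) :=
          (ENNReal.ofReal_add (Real.sqrt_nonneg _) (by linarith)).symm
  -- Step 6: the distance bounds
  have hDnn : 0 ≤ Real.sqrt V / β.toReal ^ 2 + 2 * ρ := by positivity
  have hcc : ∀ i j, dist (c i) (c j) ≤ Real.sqrt V / β.toReal ^ 2 + 2 * ρ := by
    intro i j
    rcases eq_or_ne i j with rfl | hij
    · rw [dist_self]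
      exact hDnn
    have hne : c i ≠ c j := fun h ↦ hij (hcinj h)
    have hdisj : Disjoint (closedBall (c i) ρ) (closedBall (c j) ρ) :=
      hS₀.2 (hcmem i) (hcmem j) hne
    have hA : β ≤ μ (closedBall (c i) ρ) := hS₀.1 _ (hcmem i)
    have hB : β ≤ μ (closedBall (c j) ρ) := hS₀.1 _ (hcmem j)
    -- `(d − 2ρ) β² ≤ ∫_A ∫_B d ≤ √V`
    have hint : ENNReal.ofReal (dist (c i) (c j) - 2 * ρ) * (β * β) ≤
        ENNReal.ofReal (Real.sqrt V) := by
      calc ENNReal.ofReal (dist (c i) (c j) - 2 * ρ) * (β * β)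
          ≤ ENNReal.ofReal (dist (c i) (c j) - 2 * ρ) *
              (μ (closedBall (c i) ρ) * μ (closedBall (c j) ρ)) := by gcongr
        _ = ∫⁻ _ in closedBall (c i) ρ, ∫⁻ _ in closedBall (c j) ρ,
              ENNReal.ofReal (dist (c i) (c j) - 2 * ρ) ∂μ ∂μ := by
            rw [setLIntegral_const, setLIntegral_const]
            ring
        _ ≤ ∫⁻ y in closedBall (c i) ρ, ∫⁻ z in closedBall (c j) ρ, edist y z ∂μ ∂μ := by
            refine setLIntegral_mono' measurableSet_closedBall fun y hy ↦ ?_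
            refine setLIntegral_mono' measurableSet_closedBall fun z hz ↦ ?_
            rw [edist_dist]
            refine ENNReal.ofReal_le_ofReal ?_
            rw [mem_closedBall] at hy hz
            linarith [dist_triangle (c i) y (c j), dist_triangle y z (c j), dist_comm y (c i)]
        _ ≤ ∫⁻ y, ∫⁻ z, edist y z ∂μ ∂μ :=
            (setLIntegral_le_lintegral _ _).trans
              (lintegral_mono fun y ↦ setLIntegral_le_lintegral _ _)
        _ ≤ ENNReal.ofReal (Real.sqrt V) := hdd
    -- pass to reals
    by_cases hle : dist (c i) (c j) ≤ 2 * ρ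
    · calc dist (c i) (c j) ≤ 2 * ρ := hle
        _ ≤ Real.sqrt V / β.toReal ^ 2 + 2 * ρ := by
            linarith [div_nonneg (Real.sqrt_nonneg V) (sq_nonneg β.toReal)]
    rw [not_le] at hle
    rw [← hβeq, ← ENNReal.ofReal_mul (by positivity), ← ENNReal.ofReal_mul (by linarith),
      ENNReal.ofReal_le_ofReal_iff (Real.sqrt_nonneg _)] at hint
    have hβ2 : 0 < β.toReal ^ 2 := by positivity
    rw [div_add' _ _ _ hβ2.ne', le_div_iff₀ hβ2]
    nlinarith [hint]
  have hx₀c : ∀ i, dist x₀ (c i) ≤ Real.sqrt V / β.toReal ^ 2 + 2 * ρ := by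
    intro i
    have hA : β ≤ μ (closedBall (c i) ρ) := hS₀.1 _ (hcmem i)
    have hint : ENNReal.ofReal (dist x₀ (c i) - ρ) * β ≤ ENNReal.ofReal (Real.sqrt V) := by
      calc ENNReal.ofReal (dist x₀ (c i) - ρ) * β
          ≤ ENNReal.ofReal (dist x₀ (c i) - ρ) * μ (closedBall (c i) ρ) := by gcongr
        _ = ∫⁻ _ in closedBall (c i) ρ, ENNReal.ofReal (dist x₀ (c i) - ρ) ∂μ := by
            rw [setLIntegral_const]
        _ ≤ ∫⁻ z in closedBall (c i) ρ, edist x₀ z ∂μ := by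
            refine setLIntegral_mono' measurableSet_closedBall fun z hz ↦ ?_
            rw [edist_dist]
            refine ENNReal.ofReal_le_ofReal ?_
            rw [mem_closedBall] at hz
            linarith [dist_triangle x₀ z (c i)]
        _ ≤ ∫⁻ z, edist x₀ z ∂μ := setLIntegral_le_lintegral _ _
        _ ≤ ENNReal.ofReal (Real.sqrt V) := hx₀d
    by_cases hle : dist x₀ (c i) ≤ ρ
    · calc dist x₀ (c i) ≤ ρ := hle
        _ ≤ Real.sqrt V / β.toReal ^ 2 + 2 * ρ := by
            linarith [div_nonneg (Real.sqrt_nonneg V) (sq_nonneg β.toReal)]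
    rw [not_le] at hle
    rw [← hβeq, ← ENNReal.ofReal_mul (by linarith),
      ENNReal.ofReal_le_ofReal_iff (Real.sqrt_nonneg _)] at hint
    have hβ2 : 0 < β.toReal ^ 2 := by positivity
    -- `(d − ρ) β ≤ √V` and `β ≤ 1` give `d ≤ √V/β² + 2ρ`
    have h1 : (dist x₀ (c i) - ρ) * β.toReal ^ 2 ≤ Real.sqrt V := by
      calc (dist x₀ (c i) - ρ) * β.toReal ^ 2 ≤ (dist x₀ (c i) - ρ) * β.toReal := by
            rw [sq]
            calc (dist x₀ (c i) - ρ) * (β.toReal * β.toReal)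
                = (dist x₀ (c i) - ρ) * β.toReal * β.toReal := by ring
              _ ≤ (dist x₀ (c i) - ρ) * β.toReal * 1 := by
                  gcongr
              _ = (dist x₀ (c i) - ρ) * β.toReal := mul_one _
        _ ≤ Real.sqrt V := hint
    rw [div_add' _ _ _ hβ2.ne', le_div_iff₀ hβ2]
    nlinarith [h1, hρ, hβ2]
  have hxcases : ∀ p, x p = x₀ ∨ ∃ i, x p = c i := by
    intro p
    simp only [x]
    split_ifs with h
    · exact Or.inr ⟨_, rfl⟩
    · exact Or.inl rfl
  have hdist : ∀ p q, dist (x p) (x q) ≤ Real.sqrt V / β.toReal ^ 2 + 2 * ρ := by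
    intro p q
    rcases hxcases p with hp | ⟨i, hp⟩ <;> rcases hxcases q with hq | ⟨j, hq⟩ <;> rw [hp, hq]
    · rw [dist_self]; exact hDnn
    · exact hx₀c j
    · rw [dist_comm]; exact hx₀c i
    · exact hcc i j
  exact ⟨x, T, hTmeas, hdist, hcost⟩

end Literature.Geometry.Riemannian

end
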